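import Literature.Geometry.Kaehler.RiemannSurfaceLinearCharactersIntermediateQuotient
import Literature.Geometry.Kaehler.RiemannSurfaceCyclicQuotientEigenspaces
import Mathlib.RingTheory.RootsOfUnity.Complex
import HarnessLib

/-!
# `𝓗¹(M)` of an abelian cover regrouped by cyclic quotients:
# `g = Σ_{Q = G/N cyclic} ( φ(|Q|)·(γ − 1 + δ_Q) + ½ φ(|Q|)·#{branch values q : G_q ⊄ N} )`
# and `g(M/N) = Σ_{Q' cyclic quotient of G/N} dim B_{Q'}` for `G' ≤ N ⊴ G`
# (Kopeliovich–Zemel, Theorem 7.3: for abelian `G`, `J(X)` is isogenous to `∏_Q B_Q`; Corollary 7.4)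

Layer `Literature/Geometry/Kaehler`, sequel of `RiemannSurfaceCyclicQuotientEigenspaces` (the dimension
`dim B_Q = Σ_{k ∈ (ℤ/nℤ)ˣ} dim E_{χᵏ}` of the part of `𝓗¹(M)` of ONE cyclic quotient `Q = G/ker χ`, `n = o(χ)`),
`RiemannSurfaceAbelianGroupEigenspaceDecomposition` (`g = Σ_{χ ∈ Ĝ} dim E_χ` for abelian `G`) and
`RiemannSurfaceLinearCharactersIntermediateQuotient` (`[G : ker χ] = o(χ)`, `G/ker χ` cyclic, the characters trivial on
`ker χ` are the powers of `χ`). Here the linear characters `Ĝ` of a finite group `G` are REGROUPED BY THEIR KERNELS: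
the characters with the same kernel `N = ker χ` are exactly the `φ(n)` powers `χᵏ`, `k ∈ (ℤ/nℤ)ˣ` — the faithful
characters of the cyclic quotient `Q = G/N` — and the kernels of characters are exactly the (normal) subgroups `N`
with `G/N` cyclic. Summing the Chevalley–Weil dimensions over `Ĝ` kernel by kernel gives, for an ABELIAN
`G ≤ Aut M` with `γ = g(M/G)`, the genus of `M` as the sum over the cyclic quotients `Q = G/N` of `G` of
Kopeliovich–Zemel's `dim B_Q = φ(|Q|)(γ − 1 + δ_Q) + ½ φ(|Q|)·#{q ∈ Br : G_q ⊄ N}` — the tangent-space shadow of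
the isogeny decomposition `J(X) ~ ∏_Q B_Q`. Source as printed (Y. Kopeliovich, S. Zemel, Israel J. Math. 234 (2019),
Theorem 7.3, arXiv:1609.02296 p. 32):

> Let `Q = G/N` be a cyclic quotient of `G`. Then one associates with `Q` a canonical subvariety of `J(X)`, which we
> denote by `B_Q`, whose dimension equals `φ(|Q|)[g_S − 1 + δ + Σ_{C ⊄ N} r_C/2]`, where `δ` is 1 if `N = G`
> (i.e., if `Q` is trivial) and 0 otherwise. The map `∏_Q B_Q → J(X)`, where the product is taken over all the
> cyclic quotients of `G`, has finite kernel (i.e., it is injective on the level of the tangent spaces). In case `G`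
> is Abelian, this map is surjective, and yields a decomposition of `J(X)` up to isogeny.

and from its proof (p. 32): «if `χ ∈ Ĝ` is an embedding of `Q` into `S¹` then the other elements of `Ĝ` that are
embeddings of the same quotient `Q` are precisely the images of `χ` under the Galois group `Γ_χ`, so that the cyclic
quotients of `G` are in one-to-one correspondence with representations `W ∈ Irr_ℚ(G)` with `d_W = 1`. It is also
clear that for such a representation `W` we have `k_W = φ(|Q|)` […] Finally, as all the complex irreducible
representations of an Abelian group are characters, the last assertion follows as well.»

(`J(X)` and the `B_Q` as abelian varieties are not formalised — the statements are about `Ω(1) = 𝓗¹(M) = T₀J(X)^*`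
and its eigenspaces `E_χ = ⋂_h Eig(h|𝓗¹(M), χ(h))`; «cyclic quotients `Q = G/N`» are indexed by the kernels `N` of
the linear characters, `exists_char_ker_eq_of_isCyclic_quotient` / `isCyclic_quotient_ker_char`.)

## What is proved (no definitions, no named facts, no instances)

* §1 (finite `G`, `χ ∈ Ĝ` of order `n`): `orderOf_eq_of_ker_eq`, `coprime_orderOf_of_ker_pow_eq`,
  **`filter_ker_eq_ker_eq_image_units_pow`** (`{ψ ∈ Ĝ : ker ψ = ker χ} = {χᵏ : k ∈ (ℤ/nℤ)ˣ}` — the Galois orbit of `χ`),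
  `sum_filter_ker_eq_eq_sum_units`, `card_filter_ker_eq_eq_totient` (`#{ψ : ker ψ = ker χ} = φ(n)` = «`k_W = φ(|Q|)`»);
* §2 **`exists_char_ker_eq_of_isCyclic_quotient`** (`G/N` cyclic ⟹ `N = ker χ` for some `χ ∈ Ĝ`),
  `sum_fiberwise_ker` (regrouping `Σ_{χ ∈ Ĝ}` by kernels), **`finsum_mem_range_ker_totient_index_eq_card_char`**
  (`Σ_{N} φ([G:N]) = |Ĝ|`), `finsum_mem_range_ker_totient_index_eq_card` (`= |G|` for abelian `G`);
* §3 for `G ≤ Aut M`: **`sum_filter_ker_eq_finrank_iInf_eigenspace_eq`** (any finite `G`: `Σ_{ψ ∈ Ĝ, ker ψ = N} dim E_ψ =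
  φ([G:N])(γ − 1 + [N = G]) + ½ φ([G:N])·#{q ∈ Br : G_q ⊄ N}` — THEOREM 7.3's `dim B_Q` indexed by the kernel), and
  for ABELIAN `G`: **`arithGenus_eq_finsum_mem_range_ker`**
  (`g = Σ_{N = ker χ} (φ([G:N])(γ − 1 + [N = G]) + ½ φ([G:N])·#{q ∈ Br : G_q ⊄ N})`);
* §4 intermediate abelian covers `M/N → M/G`, `G' ≤ N ⊴ G` (any finite `G ≤ Aut M`; `G/N` abelian acts on `Y = M/N` with
  `Y/(G/N) = M/G`): **`arithGenus_orbitSurface_eq_finsum_mem_range_ker`**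
  (`g(M/N) = Σ_{N' = ker χ ⊇ N} (φ([G:N'])(γ − 1 + [N' = G]) + ½ φ([G:N'])·#{q ∈ Br : G_q ⊄ N'})` — Theorem 7.3 for the
  cover `M/N → M/G`, whose cyclic quotients are the `G/N'`, `N ≤ N' = ker χ`), and for `N = ker χ₀`, `Y_Q = M/ker χ₀`:
  **`arithGenus_orbitSurface_ker_eq_finsum_mem_range_ker`** (`g(Y_Q) = Σ_{Q' quotient of Q} dim B_{Q'}` — Corollary 7.4
  (proof): «the rest come from quotients of `Q` that are coarser than `Q`»).

## References

* Y. Kopeliovich, S. Zemel, *On spaces associated with invariant divisors on Galois covers of Riemann surfaces and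
  their applications*, Israel J. Math. 234 (2019), §7, Theorem 7.3 and its proof, Corollary 7.4 (arXiv:1609.02296
  pp. 32–33). [KopeliovichZemel2019]
* J.-P. Serre, *Linear Representations of Finite Groups*, GTM 42 (1977), §2.6 Theorem 8, §3.1.
  [SerreLinearRepresentations1977]
* H. M. Farkas, I. Kra, *Riemann Surfaces*, GTM 71, 2nd ed. (1992), V.2.2 Corollary, V.2.4. [FarkasKra1992]
-/

noncomputable section

open scoped Manifold ContDiff Topology
open Set Filter Function Complex MulAction Module

namespace Literature.Geometry.Kaehler

namespace RiemannSurface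

/-! ### §1 The characters with a given kernel: the Galois orbit `{χᵏ : k ∈ (ℤ/nℤ)ˣ}` -/

section Characters

variable {G : Type*} [Group G] [Finite G] (χ : G →* ℂˣ)

/-- Characters with the same kernel have the same order (`o(χ) = [G : ker χ]`).
[cite: KopeliovichZemel2019, Theorem 7.3 (proof)] -/
theorem orderOf_eq_of_ker_eq {χ ψ : G →* ℂˣ} (h : χ.ker = ψ.ker) : orderOf χ = orderOf ψ := by
  rw [← index_ker_eq_orderOf, ← index_ker_eq_orderOf, h]

/-- If `ker χᵏ = ker χ` then `k` is prime to `o(χ)` (`o(χᵏ) = o(χ)/gcd(o(χ), k)` must equal `o(χ)`).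
[cite: KopeliovichZemel2019, Theorem 7.3 (proof)] -/
theorem coprime_orderOf_of_ker_pow_eq {k : ℕ} (h : (χ ^ k).ker = χ.ker) : k.Coprime (orderOf χ) := by
  have h1 : orderOf (χ ^ k) = orderOf χ := orderOf_eq_of_ker_eq h
  rw [(isOfFinOrder_char χ).orderOf_pow] at h1
  rcases Nat.div_eq_self.1 h1 with h0 | hg
  · exact absurd h0 (orderOf_char_pos χ).ne'
  · exact Nat.Coprime.symm hg

variable {n : ℕ} [NeZero n]

/-- **The characters with kernel `ker χ` are exactly the `χᵏ`, `k ∈ (ℤ/nℤ)ˣ`** (`n = o(χ)`): «the other elements of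
`Ĝ` that are embeddings of the same quotient `Q` are precisely the images of `χ` under the Galois group `Γ_χ`».
[cite: KopeliovichZemel2019, Theorem 7.3 (proof)] -/
theorem filter_ker_eq_ker_eq_image_units_pow (hn : orderOf χ = n) [Fintype (G →* ℂˣ)] [DecidableEq (G →* ℂˣ)]
    [DecidablePred fun ψ : G →* ℂˣ ↦ ψ.ker = χ.ker] :
    Finset.univ.filter (fun ψ : G →* ℂˣ ↦ ψ.ker = χ.ker) =
      Finset.univ.image (fun k : (ZMod n)ˣ ↦ χ ^ (k : ZMod n).val) := by
  ext ψ
  simp only [Finset.mem_filter, Finset.mem_univ, true_and, Finset.mem_image]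
  constructor
  · intro h
    obtain ⟨j, hj, rfl⟩ := exists_pow_eq_of_ker_le_ker χ h.ge
    have hcop : j.Coprime n := hn ▸ coprime_orderOf_of_ker_pow_eq χ h
    refine ⟨ZMod.unitOfCoprime j hcop, ?_⟩
    rw [ZMod.coe_unitOfCoprime, ZMod.val_natCast, Nat.mod_eq_of_lt (hn ▸ hj)]
  · rintro ⟨k, rfl⟩
    exact ker_pow_eq_ker χ (val_coe_coprime_orderOf χ hn k)

/-- Reindexing a sum over the characters with kernel `ker χ` by `(ℤ/nℤ)ˣ`, `n = o(χ)`.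
[cite: KopeliovichZemel2019, Theorem 7.3 (proof)] -/
theorem sum_filter_ker_eq_eq_sum_units (hn : orderOf χ = n) [Fintype (G →* ℂˣ)]
    [DecidablePred fun ψ : G →* ℂˣ ↦ ψ.ker = χ.ker] {α : Type*} [AddCommMonoid α] (f : (G →* ℂˣ) → α) :
    ∑ ψ ∈ Finset.univ.filter (fun ψ : G →* ℂˣ ↦ ψ.ker = χ.ker), f ψ = ∑ k : (ZMod n)ˣ, f (χ ^ (k : ZMod n).val) := by
  classical
  rw [filter_ker_eq_ker_eq_image_units_pow χ hn, Finset.sum_image]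
  rintro a - b - hab
  exact Units.ext (pow_val_injective χ hn hab)

/-- **`#{ψ ∈ Ĝ : ker ψ = ker χ} = φ(o(χ))`** («`k_W = φ(|Q|)`»). [cite: KopeliovichZemel2019, Theorem 7.3 (proof)] -/
theorem card_filter_ker_eq_eq_totient [Fintype (G →* ℂˣ)] [DecidablePred fun ψ : G →* ℂˣ ↦ ψ.ker = χ.ker] :
    (Finset.univ.filter (fun ψ : G →* ℂˣ ↦ ψ.ker = χ.ker)).card = (orderOf χ).totient := by
  haveI : NeZero (orderOf χ) := ⟨(orderOf_char_pos χ).ne'⟩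
  rw [Finset.card_eq_sum_ones, sum_filter_ker_eq_eq_sum_units χ rfl, Finset.sum_const, smul_eq_mul, mul_one,
    Finset.card_univ, ZMod.card_units_eq_totient]

end Characters

/-! ### §2 Kernels of characters = subgroups with cyclic quotient; regrouping `Ĝ` by kernels -/

section Kernels

variable {G : Type*} [Group G] [Finite G]

/-- **A (normal) subgroup `N` with `G/N` cyclic is the kernel of a linear character** (embed the cyclic group `G/N`
of order `m` onto the `m`-th roots of unity in `ℂˣ`); conversely `G/ker χ` is cyclic (`isCyclic_quotient_ker_char`):
the cyclic quotients `Q = G/N` of `G` are indexed by the kernels of the characters.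
[cite: KopeliovichZemel2019, Theorem 7.3 (proof)] -/
theorem exists_char_ker_eq_of_isCyclic_quotient (N : Subgroup G) [N.Normal] [IsCyclic (G ⧸ N)] :
    ∃ χ : G →* ℂˣ, χ.ker = N := by
  haveI : NeZero (Nat.card (G ⧸ N)) := ⟨Nat.card_pos.ne'⟩
  let e : G ⧸ N ≃* ↥(rootsOfUnity (Nat.card (G ⧸ N)) ℂ) :=
    mulEquivOfCyclicCardEq (Complex.card_rootsOfUnity (Nat.card (G ⧸ N))).symm
  refine ⟨((rootsOfUnity (Nat.card (G ⧸ N)) ℂ).subtype.comp e.toMonoidHom).comp (QuotientGroup.mk' N), ?_⟩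
  ext g
  rw [MonoidHom.mem_ker, MonoidHom.comp_apply, MonoidHom.comp_apply, QuotientGroup.mk'_apply,
    MulEquiv.coe_toMonoidHom, Subgroup.subtype_apply, OneMemClass.coe_eq_one, MulEquiv.map_eq_one_iff,
    QuotientGroup.eq_one_iff]

omit [Finite G] in
/-- Regrouping a sum over `Ĝ` by the kernels of the characters.
[cite: KopeliovichZemel2019, Theorem 7.3 (proof)] -/
theorem sum_fiberwise_ker [Fintype (G →* ℂˣ)] [DecidableEq (Subgroup G)] {α : Type*} [AddCommMonoid α]
    (f : (G →* ℂˣ) → α) :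
    ∑ N ∈ Finset.univ.image (fun χ : G →* ℂˣ ↦ χ.ker), ∑ χ ∈ Finset.univ.filter (fun χ : G →* ℂˣ ↦ χ.ker = N), f χ =
      ∑ χ : G →* ℂˣ, f χ :=
  Finset.sum_fiberwise_of_maps_to (fun χ _ ↦ Finset.mem_image_of_mem _ (Finset.mem_univ χ)) f

/-- **`Σ_{N kernel of a character} φ([G : N]) = |Ĝ|`**: `Ĝ` is the disjoint union over the cyclic quotients `Q = G/N`
of the `φ(|Q|)` faithful characters of `Q` («`k_W = φ(|Q|)`»). [cite: KopeliovichZemel2019, Theorem 7.3 (proof)] -/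
theorem finsum_mem_range_ker_totient_index_eq_card_char :
    ∑ᶠ N ∈ Set.range (fun χ : G →* ℂˣ ↦ χ.ker), N.index.totient = Nat.card (G →* ℂˣ) := by
  classical
  haveI : Fintype (G →* ℂˣ) := Fintype.ofFinite _
  rw [← Set.image_univ, ← Finset.coe_univ, ← Finset.coe_image, finsum_mem_coe_finset, Nat.card_eq_fintype_card,
    ← Finset.card_univ, Finset.card_eq_sum_ones, ← sum_fiberwise_ker fun _ ↦ 1]
  refine Finset.sum_congr rfl fun N hN ↦ ?_
  obtain ⟨χ, -, rfl⟩ := Finset.mem_image.1 hN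
  rw [← Finset.card_eq_sum_ones, card_filter_ker_eq_eq_totient χ, index_ker_eq_orderOf]

/-- For an ABELIAN finite group: **`Σ_{N : G/N cyclic} φ([G : N]) = |G|`** (`|Ĝ| = |G|`).
[cite: KopeliovichZemel2019, Theorem 7.3 (proof)] [cite: SerreLinearRepresentations1977, §3.1] -/
theorem finsum_mem_range_ker_totient_index_eq_card (hcomm : ∀ a b : G, a * b = b * a) :
    ∑ᶠ N ∈ Set.range (fun χ : G →* ℂˣ ↦ χ.ker), N.index.totient = Nat.card G := by
  haveI : Fintype G := Fintype.ofFinite _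
  rw [finsum_mem_range_ker_totient_index_eq_card_char, card_char_eq_card hcomm]

end Kernels

/-! ### §3 `g = Σ_{Q cyclic quotient} dim B_Q` for an abelian `G ≤ Aut M` -/

section OneForms

variable {M : Type*} [TopologicalSpace M] [ChartedSpace ℂ M] [IsManifold 𝓘(ℂ, ℂ) ω M]
  [CompactSpace M] [T2Space M] [PreconnectedSpace M] [Nonempty M] [Finite (autGroup M)]
  (G : Subgroup (autGroup M)) [Fintype ↥G]

open OrbitSurface

open Classical in
/-- **THEOREM 7.3 (`dim B_Q`), indexed by the kernel**: for ANY finite `G ≤ Aut M` and `χ ∈ Ĝ` with `N = ker χ`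
(`Q = G/N` cyclic of order `[G:N] = o(χ)`),
`Σ_{ψ ∈ Ĝ, ker ψ = N} dim E_ψ = φ([G:N])·(γ − 1 + [N = G]) + ½ φ([G:N])·#{branch values q : G_q ⊄ N}`
(the `ψ` with `ker ψ = N` are the `χᵏ`, `k ∈ (ℤ/o(χ)ℤ)ˣ`; `RiemannSurfaceCyclicQuotientEigenspaces` sums over those).
[cite: KopeliovichZemel2019, Theorem 7.3] -/
theorem sum_filter_ker_eq_finrank_iInf_eigenspace_eq [Fintype (↥G →* ℂˣ)] (χ : ↥G →* ℂˣ) :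
    ∑ ψ ∈ Finset.univ.filter (fun ψ : ↥G →* ℂˣ ↦ ψ.ker = χ.ker),
        (finrank ℂ ↥(⨅ h : ↥G, Module.End.eigenspace (oneFormRep M (h : autGroup M)) (ψ h : ℂ)) : ℂ) =
      (χ.ker.index.totient : ℂ) * (((arithGenus (OrbitSurface G M) : ℂ) - 1) + (if χ.ker = ⊤ then 1 else 0 : ℂ)) +
        (χ.ker.index.totient : ℂ) / 2 *
          (((branchDiv (mk G : M → OrbitSurface G M)).support.filter fun q : OrbitSurface G M ↦
            ¬ stabilizer (↥G) q.out ≤ χ.ker).card : ℂ) := by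
  haveI : NeZero (orderOf χ) := ⟨(orderOf_char_pos χ).ne'⟩
  rw [sum_filter_ker_eq_eq_sum_units χ rfl
      (fun ψ : ↥G →* ℂˣ ↦ (finrank ℂ ↥(⨅ h : ↥G, Module.End.eigenspace (oneFormRep M (h : autGroup M)) (ψ h : ℂ)) : ℂ)),
    sum_units_finrank_iInf_eigenspace_pow_eq G χ rfl, index_ker_eq_orderOf]
  simp only [MonoidHom.ker_eq_top_iff, SetLike.le_def, MonoidHom.mem_ker, not_forall, exists_prop, ne_eq]

open Classical in
/-- **THEOREM 7.3, abelian case — `g = Σ_Q dim B_Q`**: for an ABELIAN finite `G ≤ Aut M` with `γ = g(M/G)`,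
`g(M) = Σ_{N} ( φ([G:N])·(γ − 1 + [N = G]) + ½ φ([G:N])·#{branch values q : G_q ⊄ N} )`, the sum over the kernels
`N` of the linear characters of `G`, i.e. over the cyclic quotients `Q = G/N` («In case `G` is Abelian, this map is
surjective, and yields a decomposition of `J(X)` up to isogeny» — here at the level of `T₀J(X)^* = 𝓗¹(M) = ⊕_χ E_χ`).
[cite: KopeliovichZemel2019, Theorem 7.3] -/
theorem arithGenus_eq_finsum_mem_range_ker (hcomm : ∀ a b : ↥G, a * b = b * a) :
    (arithGenus M : ℂ) =
      ∑ᶠ N ∈ Set.range (fun χ : ↥G →* ℂˣ ↦ χ.ker),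
        ((N.index.totient : ℂ) * (((arithGenus (OrbitSurface G M) : ℂ) - 1) + (if N = ⊤ then 1 else 0 : ℂ)) +
          (N.index.totient : ℂ) / 2 *
            (((branchDiv (mk G : M → OrbitSurface G M)).support.filter fun q : OrbitSurface G M ↦
              ¬ stabilizer (↥G) q.out ≤ N).card : ℂ)) := by
  haveI : Fintype (↥G →* ℂˣ) := Fintype.ofFinite _
  have hg := finsum_finrank_iInf_eigenspace_oneFormRep_eq_arithGenus G hcomm
  rw [finsum_eq_sum_of_fintype] at hg
  rw [← hg, Nat.cast_sum, ← Set.image_univ, ← Finset.coe_univ, ← Finset.coe_image, finsum_mem_coe_finset,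
    ← sum_fiberwise_ker fun χ : ↥G →* ℂˣ ↦
      (finrank ℂ ↥(⨅ h : ↥G, Module.End.eigenspace (oneFormRep M (h : autGroup M)) (χ h : ℂ)) : ℂ)]
  refine Finset.sum_congr rfl fun N hN ↦ ?_
  obtain ⟨χ, -, rfl⟩ := Finset.mem_image.1 hN
  exact sum_filter_ker_eq_finrank_iInf_eigenspace_eq G χ

/-! ### §4 Intermediate abelian covers: `g(M/N) = Σ_{Q' cyclic quotient of G/N} dim B_{Q'}` -/

open Classical in
/-- **THEOREM 7.3 for an intermediate abelian cover `M/N → M/G`** (`G ≤ Aut M` any finite group, `N ⊴ G` with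
`G' ≤ N`, so that the abelian group `G/N` acts on `Y = M/N` with `Y/(G/N) = M/G`; its cyclic quotients are the `G/N'`
with `N ≤ N' = ker χ`, and a point of `Y` over `q` has stabiliser `G_qN/N ⊄ N'/N` iff `G_q ⊄ N'`):
`g(M/N) = Σ_{N' = ker χ ⊇ N} ( φ([G:N'])·(γ − 1 + [N' = G]) + ½ φ([G:N'])·#{branch values q : G_q ⊄ N'} )`
(`𝓗¹(M)^N = ⊕_{χ(N)=1} E_χ` regrouped by kernels). Here `N` is pushed into `Aut M` (`N.map G.subtype`).
[cite: KopeliovichZemel2019, Theorem 7.3, Corollary 7.4 (proof)] -/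
theorem arithGenus_orbitSurface_eq_finsum_mem_range_ker (N : Subgroup ↥G) [N.Normal] (hN : commutator ↥G ≤ N)
    [Fintype ↥(N.map G.subtype)] :
    (arithGenus (OrbitSurface ↥(N.map G.subtype) M) : ℂ) =
      ∑ᶠ N' ∈ {N' : Subgroup ↥G | N' ∈ Set.range (fun χ : ↥G →* ℂˣ ↦ χ.ker) ∧ N ≤ N'},
        ((N'.index.totient : ℂ) * (((arithGenus (OrbitSurface G M) : ℂ) - 1) + (if N' = ⊤ then 1 else 0 : ℂ)) +
          (N'.index.totient : ℂ) / 2 *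
            (((branchDiv (mk G : M → OrbitSurface G M)).support.filter fun q : OrbitSurface G M ↦
              ¬ stabilizer (↥G) q.out ≤ N').card : ℂ)) := by
  haveI : Fintype (↥G →* ℂˣ) := Fintype.ofFinite _
  have hg := finsum_mem_finrank_iInf_eigenspace_oneFormRep_eq_arithGenus G N hN
  rw [← Finset.coe_filter_univ, finsum_mem_coe_finset] at hg
  -- the index set `{N' = ker χ : N ≤ N'}` as the image of `{χ : N ≤ ker χ}` under `ker`
  have hS : {N' : Subgroup ↥G | N' ∈ Set.range (fun χ : ↥G →* ℂˣ ↦ χ.ker) ∧ N ≤ N'} =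
      ↑((Finset.univ.filter fun χ : ↥G →* ℂˣ ↦ N ≤ χ.ker).image fun χ : ↥G →* ℂˣ ↦ χ.ker) := by
    ext N'
    simp only [Set.mem_setOf_eq, Set.mem_range, Finset.coe_image, Finset.coe_filter, Finset.mem_univ, true_and,
      Set.mem_image]
    constructor
    · rintro ⟨⟨χ, rfl⟩, hle⟩
      exact ⟨χ, hle, rfl⟩
    · rintro ⟨χ, hle, rfl⟩
      exact ⟨⟨χ, rfl⟩, hle⟩
  rw [← hg, Nat.cast_sum, hS, finsum_mem_coe_finset,
    ← Finset.sum_fiberwise_of_maps_to (s := Finset.univ.filter fun χ : ↥G →* ℂˣ ↦ N ≤ χ.ker)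
      (t := (Finset.univ.filter fun χ : ↥G →* ℂˣ ↦ N ≤ χ.ker).image fun χ : ↥G →* ℂˣ ↦ χ.ker)
      (g := fun χ : ↥G →* ℂˣ ↦ χ.ker) (fun χ hχ ↦ Finset.mem_image_of_mem _ hχ)
      (fun χ : ↥G →* ℂˣ ↦
        (finrank ℂ ↥(⨅ h : ↥G, Module.End.eigenspace (oneFormRep M (h : autGroup M)) (χ h : ℂ)) : ℂ))]
  refine Finset.sum_congr rfl fun N' hN' ↦ ?_
  obtain ⟨χ, hχ, rfl⟩ := Finset.mem_image.1 hN'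
  have hle : N ≤ χ.ker := (Finset.mem_filter.1 hχ).2
  -- inside `{ψ : N ≤ ker ψ}` the fibre of `ker χ ⊇ N` is the whole fibre `{ψ : ker ψ = ker χ}`
  have hfib : (Finset.univ.filter fun ψ : ↥G →* ℂˣ ↦ N ≤ ψ.ker).filter (fun ψ : ↥G →* ℂˣ ↦ ψ.ker = χ.ker) =
      Finset.univ.filter fun ψ : ↥G →* ℂˣ ↦ ψ.ker = χ.ker := by
    ext ψ
    simp only [Finset.mem_filter, Finset.mem_univ, true_and]
    exact ⟨fun h ↦ h.2, fun h ↦ ⟨by rw [h]; exact hle, h⟩⟩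
  exact (Finset.sum_congr hfib fun _ _ ↦ rfl).trans (sum_filter_ker_eq_finrank_iInf_eigenspace_eq G χ)

open Classical in
/-- **COROLLARY 7.4 (proof) at the level of `T₀`: `g(Y_Q) = Σ_{Q' quotient of Q} dim B_{Q'}`** for a linear character
`χ₀` of any finite `G ≤ Aut M`, `Q = G/ker χ₀` cyclic, `Y_Q = M/ker χ₀`: the genus of `Y_Q` is the sum, over the kernels
`N' = ker χ ⊇ ker χ₀` (the quotients `Q' = G/N'` of `Q`), of `φ(|Q'|)·(γ − 1 + [Q' = 1]) + ½ φ(|Q'|)·#{q : G_q ⊄ N'}`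
(«It follows that `B_W ⊆ J(X)` is the image of `P̃(Y_Q/S) ⊆ J(Y_Q)`. The other parts of `J(Y_Q)` […] come from
non-invertible powers of a character `χ ∈ Ĝ` that reduces to a faithful character of `Q` […] coarser quotients»).
[cite: KopeliovichZemel2019, Corollary 7.4 (proof), Theorem 7.3] -/
theorem arithGenus_orbitSurface_ker_eq_finsum_mem_range_ker (χ₀ : ↥G →* ℂˣ) [Fintype ↥(χ₀.ker.map G.subtype)] :
    (arithGenus (OrbitSurface ↥(χ₀.ker.map G.subtype) M) : ℂ) =
      ∑ᶠ N' ∈ {N' : Subgroup ↥G | N' ∈ Set.range (fun χ : ↥G →* ℂˣ ↦ χ.ker) ∧ χ₀.ker ≤ N'},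
        ((N'.index.totient : ℂ) * (((arithGenus (OrbitSurface G M) : ℂ) - 1) + (if N' = ⊤ then 1 else 0 : ℂ)) +
          (N'.index.totient : ℂ) / 2 *
            (((branchDiv (mk G : M → OrbitSurface G M)).support.filter fun q : OrbitSurface G M ↦
              ¬ stabilizer (↥G) q.out ≤ N').card : ℂ)) :=
  arithGenus_orbitSurface_eq_finsum_mem_range_ker G χ₀.ker (Abelianization.commutator_subset_ker χ₀)

end OneForms

end RiemannSurface

end Literature.Geometry.Kaehler
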